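import Mathlib
import HarnessLib
import Summits.NavierStokesRegularity.NavierStokesRegularity.Theorems.TypeILiouvilleStrainLedgerStarved
import Summits.NavierStokesRegularity.NavierStokesRegularity.Theorems.TypeILiouvilleQuiescentShadow
import Summits.NavierStokesRegularity.NavierStokesRegularity.Theorems.TypeILiouvilleQuiescentGradient
import Literature.Analysis.FluidPDE.VorticityCalculus

/-!
# TypeILiouvilleQuiescentVorticity — crux (L) stmt-NavierStokesRegularity-10661 `TypeIliouvilleL`, registered stub
# `stub_quiescentLiouville` (L_Q): THE C⁰ DIAL IS THE VORTICITY DIAL — quiescent ⟺ `sup_x ‖ω(t,x)‖ → 0`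

Helper for stmt-NavierStokesRegularity-10661 (`--supports`); theorems only, no definitions, no named-fact hypotheses;
closes no item; Navier–Stokes regularity is NOT proved here (leafhand seat of the EulerZoomLiouville route).
Class P = print's class of bounded ancient mild solutions (continuous and bounded on `(−∞,0) × ℝ³`, weakly divergence
free, Oseen integral equation).  `TypeILiouvilleQuiescentGradient` (p814740) proved QUIESCENT ⟺ `sup_x‖∇v(t,·)‖ → 0`.
Here the dial is lowered once more, to the ANTISYMMETRIC part of the gradient only:

* `curl_eq_zero_of_integral_inner_eq_zero` — a `C¹` field whose curl is orthogonal to every `C^∞_c` test field has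
  vanishing curl (du Bois-Reymond).
* `quiescent_of_curl_fading` — **in class P, `sup_x‖ω(t,x)‖ → 0` as `t → −∞` ⟹ QUIESCENT.**  Proof by compactness:
  if the unit oscillation stays `≥ ε` along `t_k → −∞`, the KNSS extraction on the translates
  (`TypeILiouvilleQuiescentShadow.ancientShadow_exists`) yields a class-P limit `W` with a NON-constant slice (uniform
  Lipschitz bound of class P), yet every slice of `W` is weakly — hence classically — curl-free (dominated convergence +
  integration by parts `integral_inner_curl_eq_integral_inner_curl`), so `W` is constant
  (`TypeILiouvilleStrainLedger.const_of_curl_eq_zero`): contradiction.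
* `curl_fading_of_quiescent` — the converse (`‖ω‖ ≤ ‖curl‖·‖∇v‖` and p814740).
* `quiescentLiouville_iff_vorticityFadingLiouville` — **L_Q ⟺ VORTICITY-FADING LIOUVILLE** («every class-P flow with
  `sup_x‖ω(t,x)‖ → 0` as `t → −∞` is one constant vector»), binders of the registered stub verbatim on the left.

READING: the registered residual of the (L) crux is a statement about VORTICITY DECAY ALONE; with the strain ledger
(`…StrainLedgerStarved/StretchingFloor/Aligned`) every dial of L_Q is now a vorticity/strain dial.
[cite: KochNadirashviliSereginSverak2009, Lemma 6.1 and §4 (arXiv:0709.3599)]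
-/

noncomputable section
open MeasureTheory Filter Set Function Metric
open scoped Topology RealInnerProductSpace ENNReal NNReal ContDiff
open Literature.Analysis Literature.Analysis.FluidPDE Literature.Analysis.UnboundedOperators
set_option linter.dupNamespace false
namespace Summit.NavierStokesRegularity.NavierStokesRegularity.Theorems.TypeILiouvilleStrainLedger

/-- **du Bois-Reymond for the curl.**  A `C¹` field `F : ℝ³ → ℝ³` with `∫ ⟪curl F, Ψ⟫ = 0` for every compactly
supported `C^∞` test field `Ψ` has `curl F ≡ 0` (test against `Ψ = g • c`, Mathlib's
`ae_eq_zero_of_integral_contDiff_smul_eq_zero`, continuity of `curl F`). [folklore] -/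
theorem curl_eq_zero_of_integral_inner_eq_zero {F : EuclideanSpace ℝ (Fin 3) → EuclideanSpace ℝ (Fin 3)}
    (hF : ContDiff ℝ 1 F)
    (h : ∀ Ψ : EuclideanSpace ℝ (Fin 3) → EuclideanSpace ℝ (Fin 3), ContDiff ℝ ∞ Ψ → HasCompactSupport Ψ →
      ∫ x, ⟪curl F x, Ψ x⟫ = 0) :
    ∀ x, curl F x = 0 := by
  have hcurlc : Continuous (curl F) := continuous_curl hF
  -- every component `⟪curl F, c⟫` vanishes
  have hcomp : ∀ c : EuclideanSpace ℝ (Fin 3), ∀ x, ⟪curl F x, c⟫ = 0 := by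
    intro c
    have hli : LocallyIntegrable (fun x => ⟪curl F x, c⟫) (volume : Measure (EuclideanSpace ℝ (Fin 3))) :=
      (hcurlc.inner continuous_const).locallyIntegrable
    have hae := ae_eq_zero_of_integral_contDiff_smul_eq_zero hli fun g hg hgs => by
      have hΨ : ContDiff ℝ ∞ (fun x => g x • c) := hg.smul contDiff_const
      have hΨs : HasCompactSupport (fun x => g x • c) := hgs.smul_right (f' := fun _ => c)
      have h1 := h _ hΨ hΨs
      simp only [real_inner_smul_right] at h1
      simpa only [smul_eq_mul] using h1
    have hcont : Continuous (fun x => ⟪curl F x, c⟫) := hcurlc.inner continuous_const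
    have heq := (Continuous.ae_eq_iff_eq volume hcont continuous_const).1 hae
    exact fun x => congrFun heq x
  intro x
  exact inner_self_eq_zero.1 (hcomp (curl F x) x)

/-- **THE VORTICITY DIAL: in print's class, `sup_x ‖ω(t,x)‖ → 0` as `t → −∞` implies QUIESCENCE** (unit oscillation of
the slices `→ 0`).  Compactness proof: see the module docstring. [cite: KochNadirashviliSereginSverak2009, Lemma 6.1 (arXiv:0709.3599)] -/
theorem quiescent_of_curl_fading
    {v : ℝ → EuclideanSpace ℝ (Fin 3) → EuclideanSpace ℝ (Fin 3)}
    (hc : ContinuousOn (uncurry v) (Iio 0 ×ˢ univ))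
    (hK : ∃ K : ℝ, ∀ t < 0, ∀ x, ‖v t x‖ ≤ K)
    (hd : ∀ t < 0, IsWeaklyDivFree (v t))
    (hm : ∀ s t : ℝ, s < t → t < 0 → ∀ x,
      v t x = heatExtension (v s) (t - s) x - oseenDuhamel 1 s v v t x)
    (hω : ∀ η : ℝ, 0 < η → ∃ T : ℝ, T < 0 ∧ ∀ τ < T, ∀ x, ‖curl (v τ) x‖ ≤ η) :
    ∀ ε : ℝ, 0 < ε → ∃ T : ℝ, T < 0 ∧ ∀ t < T, ∀ x y : EuclideanSpace ℝ (Fin 3),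
      dist x y ≤ 1 → ‖v t x - v t y‖ ≤ ε := by
  obtain ⟨K, hKb⟩ := hK
  by_contra hnq
  push Not at hnq
  obtain ⟨ε, hε, hbad⟩ := hnq
  -- bad times `t_k < −(k+2)` with oscillating pairs
  choose tk htk xk yk hxy hosc using fun k : ℕ => hbad (-((k : ℝ) + 2)) (by linarith [(Nat.cast_nonneg k : (0:ℝ) ≤ k)])
  -- uniform Lipschitz bound of class P
  obtain ⟨hsm', hbounds⟩ := smooth_and_bounds_of_bounded_ancient_oseenMild hc hd hm hKb
  have hsm : IsSmoothSpaceTimeOn (Iio 0) v := hsm'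
  obtain ⟨C₁, hC₁⟩ := hbounds 1
  have hC₁' : ∀ τ < 0, ∀ x, ‖fderiv ℝ (v τ) x‖ ≤ C₁ := fun τ hτ x => by
    have := hC₁ τ hτ x; rwa [norm_iteratedFDeriv_one] at this
  have hslice1 : ∀ τ < 0, ContDiff ℝ 1 (v τ) := fun τ hτ =>
    (hsm.contDiff_slice (mem_Iio.2 hτ)).of_le (by norm_cast)
  have hlip : ∀ τ < 0, ∀ x y, ‖v τ y - v τ x‖ ≤ C₁ * ‖y - x‖ := fun τ hτ x y =>
    (convex_univ (𝕜 := ℝ)).norm_image_sub_le_of_norm_fderiv_le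
      (fun z _ => ((hslice1 τ hτ).differentiable one_ne_zero z)) (fun z _ => hC₁' τ hτ z) (mem_univ x) (mem_univ y)
  have hC₁0 : 0 ≤ C₁ := (norm_nonneg _).trans (hC₁' (-1) (by norm_num) 0)
  -- the translates `w_k(t,x) = v(t + (t_k + 1), x + x_k)` and their KNSS limit
  have htk' : ∀ k, tk k + 1 ≤ 0 := fun k => by linarith [htk k, (Nat.cast_nonneg k : (0:ℝ) ≤ k)]
  obtain ⟨φ, W, hφ, hWc, hWd, hWb, hWm, hpt⟩ :=
    TypeILiouvilleQuiescentShadow.ancientShadow_exists hc hKb hd hm (fun k => tk k + 1) htk' xk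
  -- a further subsequence along which `d_k = y_k − x_k` converges in the closed unit ball
  have hdmem : ∀ j, yk (φ j) - xk (φ j) ∈ closedBall (0 : EuclideanSpace ℝ (Fin 3)) 1 := fun j => by
    rw [mem_closedBall, dist_zero_right, ← dist_eq_norm, dist_comm]; exact hxy (φ j)
  obtain ⟨d, -, ψ, hψ, hdlim⟩ := (isCompact_closedBall (0 : EuclideanSpace ℝ (Fin 3)) 1).tendsto_subseq hdmem
  -- (1) the limit slice `W (−1)` is NOT constant: `‖W(−1) 0 − W(−1) d‖ ≥ ε`
  have h1 : (-1 : ℝ) < 0 := by norm_num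
  have hlim0 : Tendsto (fun j => v (-1 + (tk (φ (ψ j)) + 1)) (0 + xk (φ (ψ j)))) atTop (𝓝 (W (-1) 0)) :=
    (hpt (-1) h1 0).comp hψ.tendsto_atTop
  have hlimd : Tendsto (fun j => v (-1 + (tk (φ (ψ j)) + 1)) (d + xk (φ (ψ j)))) atTop (𝓝 (W (-1) d)) :=
    (hpt (-1) h1 d).comp hψ.tendsto_atTop
  have hge : ε ≤ ‖W (-1) 0 - W (-1) d‖ := by
    -- `ε < ‖v(t_n) x_n − v(t_n) y_n‖ ≤ ‖v(t_n)(x_n) − v(t_n)(x_n + d)‖ + C₁ ‖d − d_n‖`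
    have hF : Tendsto (fun j => ‖v (-1 + (tk (φ (ψ j)) + 1)) (0 + xk (φ (ψ j))) -
        v (-1 + (tk (φ (ψ j)) + 1)) (d + xk (φ (ψ j)))‖ +
        C₁ * ‖d - (yk (φ (ψ j)) - xk (φ (ψ j)))‖) atTop (𝓝 (‖W (-1) 0 - W (-1) d‖ + C₁ * 0)) := by
      refine ((hlim0.sub hlimd).norm).add (Tendsto.const_mul C₁ ?_)
      have := (tendsto_iff_norm_sub_tendsto_zero.1 hdlim)
      refine this.congr fun j => ?_
      simp only [Function.comp_apply, norm_sub_rev]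
    rw [mul_zero, add_zero] at hF
    refine ge_of_tendsto hF (Eventually.of_forall fun j => ?_)
    set n := φ (ψ j) with hn
    have htn : tk n < 0 := by linarith [htk n, (Nat.cast_nonneg n : (0:ℝ) ≤ n)]
    have hs : -1 + (tk n + 1) = tk n := by ring
    rw [hs, zero_add]
    have htri : ‖v (tk n) (xk n) - v (tk n) (yk n)‖ ≤
        ‖v (tk n) (xk n) - v (tk n) (d + xk n)‖ + ‖v (tk n) (d + xk n) - v (tk n) (yk n)‖ :=
      norm_sub_le_norm_sub_add_norm_sub _ _ _
    have hl := hlip (tk n) htn (yk n) (d + xk n)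
    have hdd : ‖d + xk n - yk n‖ = ‖d - (yk n - xk n)‖ := by congr 1; abel
    rw [hdd] at hl
    linarith [hosc n]
  -- (2) every slice of `W` is curl-free
  have hWcurl : ∀ t < 0, ∀ x, curl (W t) x = 0 := by
    intro t ht
    -- `W` is smooth (class P)
    obtain ⟨hWsm', -⟩ := smooth_and_bounds_of_bounded_ancient_oseenMild hWc hWd hWm hWb
    have hWsm : IsSmoothSpaceTimeOn (Iio 0) W := hWsm'
    have hWt1 : ContDiff ℝ 1 (W t) := (hWsm.contDiff_slice (mem_Iio.2 ht)).of_le (by norm_cast)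
    refine curl_eq_zero_of_integral_inner_eq_zero hWt1 fun Ψ hΨ hΨs => ?_
    have hΨ1 : ContDiff ℝ 1 Ψ := hΨ.of_le (by norm_cast)
    rw [integral_inner_curl_eq_integral_inner_curl hWt1 hΨ1 hΨs]
    -- the translates at time `t`
    set w : ℕ → EuclideanSpace ℝ (Fin 3) → EuclideanSpace ℝ (Fin 3) :=
      fun j x => v (t + (tk (φ j) + 1)) (x + xk (φ j)) with hw_def
    have hτ : ∀ j, t + (tk (φ j) + 1) < 0 := fun j => by linarith [htk' (φ j)]
    have hwc : ∀ j, Continuous (w j) := fun j => by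
      have hsl : Continuous (v (t + (tk (φ j) + 1))) :=
        hc.comp_continuous (Continuous.prodMk_right _) fun x => mem_prod.2 ⟨hτ j, mem_univ x⟩
      exact hsl.comp (continuous_id.add continuous_const)
    have hw1 : ∀ j, ContDiff ℝ 1 (w j) := fun j =>
      (hslice1 _ (hτ j)).comp (contDiff_id.add contDiff_const)
    -- dominated convergence: `∫ ⟪w_j, curl Ψ⟫ → ∫ ⟪W t, curl Ψ⟫`
    have hcΨc : Continuous (curl Ψ) := continuous_curl hΨ1
    have hcΨs : HasCompactSupport (curl Ψ) := hasCompactSupport_curl hΨs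
    have hlimI : Tendsto (fun j => ∫ x, ⟪w j x, curl Ψ x⟫) atTop (𝓝 (∫ x, ⟪W t x, curl Ψ x⟫)) := by
      refine tendsto_integral_of_dominated_convergence (fun x => K * ‖curl Ψ x‖)
        (fun j => ((hwc j).inner hcΨc).aestronglyMeasurable) ?_ ?_ ?_
      · exact ((hcΨc.norm.const_mul K).integrable_of_hasCompactSupport hcΨs.norm.mul_left)
      · intro j
        refine Eventually.of_forall fun x => ?_
        calc ‖⟪w j x, curl Ψ x⟫‖ ≤ ‖w j x‖ * ‖curl Ψ x‖ := norm_inner_le_norm _ _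
          _ ≤ K * ‖curl Ψ x‖ := mul_le_mul_of_nonneg_right (hKb _ (hτ j) _) (norm_nonneg _)
      · exact Eventually.of_forall fun x => (hpt t ht x).inner tendsto_const_nhds
    -- integration by parts on each translate, and the curl of the translates is uniformly small
    have hlim0' : Tendsto (fun j => ∫ x, ⟪w j x, curl Ψ x⟫) atTop (𝓝 0) := by
      have hIΨ : Integrable (fun x => ‖Ψ x‖) (volume : Measure (EuclideanSpace ℝ (Fin 3))) :=
        (hΨ.continuous.norm).integrable_of_hasCompactSupport hΨs.norm
      rw [Metric.tendsto_atTop]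
      intro η hη
      have hA0' : 0 ≤ ∫ x, ‖Ψ x‖ := integral_nonneg fun x => norm_nonneg _
      obtain ⟨A, hA0, hAeq⟩ : ∃ A : ℝ, 0 ≤ A ∧ ∫ x, ‖Ψ x‖ = A := ⟨_, hA0', rfl⟩
      have h2A : 0 < 2 * (A + 1) := by linarith
      obtain ⟨T, hT0, hT⟩ := hω (η / (2 * (A + 1))) (div_pos hη h2A)
      -- `t + t_{φ j} + 1 < T` eventually
      have htend : Tendsto (fun j => t + (tk (φ j) + 1)) atTop atBot := by
        have h2 : Tendsto (fun j => -((φ j : ℕ) : ℝ)) atTop atBot :=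
          tendsto_neg_atTop_atBot.comp (tendsto_natCast_atTop_atTop.comp hφ.tendsto_atTop)
        refine tendsto_atBot_mono (fun j => ?_) (tendsto_atBot_add_const_left _ (t + 1 - 2 + 1) h2)
        have := htk (φ j)
        linarith
      obtain ⟨N, hN⟩ := (htend.eventually (eventually_lt_atBot T)).exists_forall_of_atTop
      refine ⟨N, fun j hj => ?_⟩
      rw [dist_zero_right, ← integral_inner_curl_eq_integral_inner_curl (hw1 j) hΨ1 hΨs]
      have hsmall : ∀ x, ‖curl (w j) x‖ ≤ η / (2 * (A + 1)) := fun x => by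
        have hcw : curl (w j) x = curl (v (t + (tk (φ j) + 1))) (x + xk (φ j)) := by
          show curlCLM (fderiv ℝ (fun y => v (t + (tk (φ j) + 1)) (y + xk (φ j))) x) =
            curlCLM (fderiv ℝ (v (t + (tk (φ j) + 1))) (x + xk (φ j)))
          rw [fderiv_comp_add_right]
        rw [hcw]
        exact hT _ (hN j hj) _
      calc ‖∫ x, ⟪curl (w j) x, Ψ x⟫‖ ≤ ∫ x, ‖⟪curl (w j) x, Ψ x⟫‖ := norm_integral_le_integral_norm _
        _ ≤ ∫ x, η / (2 * (A + 1)) * ‖Ψ x‖ := by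
            refine integral_mono_of_nonneg (Eventually.of_forall fun x => norm_nonneg _)
              (hIΨ.const_mul _) (Eventually.of_forall fun x => ?_)
            calc ‖⟪curl (w j) x, Ψ x⟫‖ ≤ ‖curl (w j) x‖ * ‖Ψ x‖ := norm_inner_le_norm _ _
              _ ≤ η / (2 * (A + 1)) * ‖Ψ x‖ := mul_le_mul_of_nonneg_right (hsmall x) (norm_nonneg _)
        _ = η / (2 * (A + 1)) * A := by rw [integral_const_mul, hAeq]
        _ < η := by
            rw [div_mul_eq_mul_div, div_lt_iff₀ h2A]
            nlinarith
    rw [tendsto_nhds_unique hlimI hlim0']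
  -- (3) hence `W` is one constant vector — contradiction with (1)
  obtain ⟨b, hb⟩ := const_of_curl_eq_zero hWc ⟨K, hWb⟩ hWd hWm hWcurl
  have h0 : W (-1) 0 - W (-1) d = 0 := by rw [hb (-1) h1 0, hb (-1) h1 d, sub_self]
  rw [h0, norm_zero] at hge
  exact absurd hge (not_le.2 hε)

/-- The converse dial: **quiescent ⟹ `sup_x ‖ω(t,x)‖ → 0`** (`‖curl‖ ≤ ‖curlCLM‖·‖∇v‖` and
`TypeILiouvilleQuiescentGradient.fderiv_small_of_quiescent`). [cite: KochNadirashviliSereginSverak2009, §4 (arXiv:0709.3599)] -/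
theorem curl_fading_of_quiescent
    {v : ℝ → EuclideanSpace ℝ (Fin 3) → EuclideanSpace ℝ (Fin 3)}
    (hc : ContinuousOn (uncurry v) (Iio 0 ×ˢ univ))
    (hK : ∃ K : ℝ, ∀ t < 0, ∀ x, ‖v t x‖ ≤ K)
    (hd : ∀ t < 0, IsWeaklyDivFree (v t))
    (hm : ∀ s t : ℝ, s < t → t < 0 → ∀ x,
      v t x = heatExtension (v s) (t - s) x - oseenDuhamel 1 s v v t x)
    (hq : ∀ ε : ℝ, 0 < ε → ∃ T : ℝ, T < 0 ∧ ∀ t < T, ∀ x y : EuclideanSpace ℝ (Fin 3),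
      dist x y ≤ 1 → ‖v t x - v t y‖ ≤ ε) :
    ∀ η : ℝ, 0 < η → ∃ T : ℝ, T < 0 ∧ ∀ τ < T, ∀ x, ‖curl (v τ) x‖ ≤ η := by
  intro η hη
  obtain ⟨T, hT0, hT⟩ := TypeILiouvilleQuiescentGradient.fderiv_small_of_quiescent hc hK hd hm hq
    (η / (‖curlCLM‖ + 1)) (by positivity)
  refine ⟨T, hT0, fun τ hτ x => ?_⟩
  calc ‖curl (v τ) x‖ = ‖curlCLM (fderiv ℝ (v τ) x)‖ := rfl
    _ ≤ ‖curlCLM‖ * ‖fderiv ℝ (v τ) x‖ := ContinuousLinearMap.le_opNorm _ _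
    _ ≤ ‖curlCLM‖ * (η / (‖curlCLM‖ + 1)) := mul_le_mul_of_nonneg_left (hT τ hτ x) (norm_nonneg curlCLM)
    _ ≤ η := by
        rw [mul_div_assoc', div_le_iff₀ (by positivity)]
        nlinarith [norm_nonneg curlCLM]

/-- **L_Q ⟺ VORTICITY-FADING LIOUVILLE** (exact, unconditional).  Left: the registered stub `stub_quiescentLiouville` of
the (L) crux, binders verbatim.  Right: «every class-P flow with `sup_x ‖curl v(t,x)‖ → 0` as `t → −∞` is one
constant vector».  [cite: KochNadirashviliSereginSverak2009, Lemma 6.1 and §4 (arXiv:0709.3599)] -/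
theorem quiescentLiouville_iff_vorticityFadingLiouville :
    (∀ v : ℝ → EuclideanSpace ℝ (Fin 3) → EuclideanSpace ℝ (Fin 3),
      ContinuousOn (Function.uncurry v) (Set.Iio 0 ×ˢ Set.univ) →
      (∃ K : ℝ, ∀ t < 0, ∀ x, ‖v t x‖ ≤ K) →
      (∀ t < 0, Literature.Analysis.FluidPDE.IsWeaklyDivFree (v t)) →
      (∀ s t : ℝ, s < t → t < 0 → ∀ x,
        v t x = Literature.Analysis.UnboundedOperators.heatExtension (v s) (t - s) x -
          Literature.Analysis.FluidPDE.oseenDuhamel 1 s v v t x) →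
      (∀ ε : ℝ, 0 < ε → ∃ T : ℝ, T < 0 ∧ ∀ t < T, ∀ x y : EuclideanSpace ℝ (Fin 3),
        dist x y ≤ 1 → ‖v t x - v t y‖ ≤ ε) →
      ∃ b : EuclideanSpace ℝ (Fin 3), ∀ t < 0, ∀ x, v t x = b) ↔
    (∀ v : ℝ → EuclideanSpace ℝ (Fin 3) → EuclideanSpace ℝ (Fin 3),
      ContinuousOn (Function.uncurry v) (Set.Iio 0 ×ˢ Set.univ) →
      (∃ K : ℝ, ∀ t < 0, ∀ x, ‖v t x‖ ≤ K) →
      (∀ t < 0, Literature.Analysis.FluidPDE.IsWeaklyDivFree (v t)) →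
      (∀ s t : ℝ, s < t → t < 0 → ∀ x,
        v t x = Literature.Analysis.UnboundedOperators.heatExtension (v s) (t - s) x -
          Literature.Analysis.FluidPDE.oseenDuhamel 1 s v v t x) →
      (∀ η : ℝ, 0 < η → ∃ T : ℝ, T < 0 ∧ ∀ τ < T, ∀ x, ‖curl (v τ) x‖ ≤ η) →
      ∃ b : EuclideanSpace ℝ (Fin 3), ∀ t < 0, ∀ x, v t x = b) :=
  ⟨fun hQ v hc hK hd hm hω => hQ v hc hK hd hm (quiescent_of_curl_fading hc hK hd hm hω),
    fun hV v hc hK hd hm hq => hV v hc hK hd hm (curl_fading_of_quiescent hc hK hd hm hq)⟩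

end Summit.NavierStokesRegularity.NavierStokesRegularity.Theorems.TypeILiouvilleStrainLedger

end
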